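import Literature.NumberTheory.Automorphic.Liu2021.AppendixC.Glue
import Literature.AlgebraicGeometry.Motives.Jacobian
import Literature.AlgebraicGeometry.Motives.AlbaneseExistenceComplex
import Literature.AlgebraicGeometry.Motives.BaseChange
import Literature.AlgebraicGeometry.Motives.AbelianVarietyProjective
import HarnessLib

/-!
# Liu 2021 §2.1: the Albanese variety `Alb_X` — existence AS PRINTED, and its behaviour under extension of the base
# field on the components (named facts; the existence of the Albanese data of the complex pieces is a theorem of the tree)

[Liu2021] = Yifeng Liu, *Fourier–Jacobi cycles and arithmetic relative trace formula*, Cambridge J. Math. **9**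
(2021) = arXiv:2102.11518; line numbers `l. NNNN` refer to the author's TeX source `FJcycle.tex` (md5
`6db49a74122d2cb0f224fa1b39488a0c`), as in `Liu2021/AppendixC/Glue.lean`, whose structure `AppendixC.Albanese X`
(Def. 2.3 with the Proposition before it, l. 1190–1208) — Liu's POINT-FREE Albanese datum `α_X : ∇X → Alb_X` of a
proper smooth `k`-scheme `X`, corepresenting `A ↦ {f : ∇X → A | ΔX ⊆ f⁻¹ 0_A}` — is the object of this file.

## What is printed, and what this file records

* Proposition (l. 1190–1192) and its PROOF (l. 1194–1200): «Let `k'` be a separable closure of `k`. Then `k'`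
  splits `X` […]. Put `X' := X_{k'}`. […] Pick an element `x ∈ X(π₀(X'))` […]. By Serre's construction [Ser59] of
  the Albanese variety (see [Wit08, Appendix A] for a version over separably closed field), we have a morphism
  `g_x : X' → Alb_{X'}`, universal among all morphisms `g : X' → A` to an abelian variety `A` over `k'` such that
  `g(x) = 0_A`. Now it is easy to see that the composite morphism `∇_{k'}X' → Alb_{X'} ×_{k'} Alb_{X'} → Alb_{X'}`
  (difference) does not depend on the choice of `x`, and corepresents the functor `Alb_{X'}`. […] As
  `(∇X)_{k'} ≃ ∇_{k'}X'`, the statement for `X` then follows by Galois descent.»  So `Alb_X` is CONSTRUCTED so that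
  `(Alb_X)_{k'} = Alb_{X'}`, and on the split scheme `X' = ⊔ᵢ Xᵢ` (every `Xᵢ` geometrically connected) Serre's
  Albanese pointed at one point per component is `∏ᵢ Alb_{Xᵢ}`, `∇_{k'}X' = ⊔ᵢ Xᵢ × Xᵢ`.
* Lemma 2.2 (1) (l. 1211–1213, `k` of characteristic zero): «for every homomorphism `τ : k → ℂ`, we have a canonical
  isomorphism `H¹_{B,τ}(Alb_X, ℚ) ≃ H¹_{B,τ}(X, ℚ)`», whose PROOF (l. 1220–1228) reads «we pick an element
  `x ∈ X(π₀(X ⊗_{k,τ} ℂ))`, which induces a morphism `(α_X)_x : X ⊗_{k,τ} ℂ → Alb_X ⊗_{k,τ} ℂ` […]. By the property of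
  complex Albanese varieties, the induced map `(α_X)_x^*` […] is an isomorphism» — i.e. `Alb_X ⊗_{k,τ} ℂ`, pointed
  componentwise, IS the complex Albanese variety of `X ⊗_{k,τ} ℂ = ⊔_c Y_c`, the product of the `Alb(Y_c)`.
* The classical input behind both steps — the formation of the Albanese variety of a proper (geometrically reduced,
  geometrically connected) scheme commutes with arbitrary extension of the base field — is Grothendieck, FGA, TDTE VI
  (Sém. Bourbaki 236), Thm. 3.3 (iii), in the form [AchterCasalainaMartinVial2026, Thm. 3.2 (Grothendieck–Conrad)
  and Rem. 3.3, pp. 807–808]: «Let `V` be a proper geometrically connected and geometrically reduced scheme over a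
  field `K`. Then Albanese data for `V` is stable under base change of field».

This file records FIRST the Proposition itself, AS PRINTED (`exists_albanese`: a proper smooth `X` over any field has
an Albanese datum `AppendixC.Albanese X` — corepresentability; not consumed by the COR-CM closed term, whose Appendix-C
carrier `Sec42Data` stays posited, but the non-vacuity exit for its field `alb`), and SECOND the base-change consequence.

The tree's `Motives.Jacobian Y` (file `Motives/Jacobian`) is, for any `L`-scheme `Y`, an Albanese datum of `Y` in
the point-free form «difference map `Y × Y → J` universal among morphisms trivial on the diagonal» (Milne, *Jacobian
Varieties*, Prop. 6.4 / Remark 6.5) — for a geometrically connected `Y` this is Liu's functor (`∇Y = Y × Y`), and it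
is Serre's pointed Albanese by Milne Prop. 6.1 ⇔ 6.4 (tree `Jacobian.ofPointed`, `Jacobian.descPointed`).  Hence the
second NAMED FACT of this file, `albanese_baseChange_isLimit_fan_jacobian`:

  for `σ : k →+* L` (`k` of characteristic zero, `L` algebraically closed — the consumer's `L = ℂ`), a proper smooth
  `X/k` with a Liu Albanese datum `a`, and ANY finite coproduct decomposition `X ⊗_{k,σ} L ≅ ∐_c Y_c` into smooth
  projective irreducible `L`-schemes with Albanese data `𝒥 c : Jacobian (Y c)`, the base change `a.Alb ⊗_{k,σ} L` is
  a PRODUCT `∏_c (𝒥 c).J` in the category of abelian varieties over `L` (a limit fan).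

READING (the only interpretive choice): the displayed isomorphism `Alb_X ⊗_{k,σ} L ≅ ∏_c Alb(Y_c)` is not ONE printed
sentence of [Liu2021]; it is the conjunction of the Proposition's proof («`(∇X)_{k'} ≃ ∇_{k'}X'`», Serre's pointed
Albanese per component, Galois descent), of the use made of it in the proof of Lemma 2.2 (1) at `τ : k → ℂ`, and of
Grothendieck's base-change theorem as cited — the docstring of the fact separates the printed clause (a) from the
unprinted steps (i) uniqueness/descent, (ii) base change `k' → L`, (iii) pointed vs point-free Albanese, each with its
own citation (TEAM hComp referee ruling R-3).  Existence of the `𝒥 c` is NOT part of the fact: over `L = ℂ` it is the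
tree's THEOREM `Motives.nonempty_jacobian_of_isSmoothProjective_complex_of_dim` (`Motives/AlbaneseExistenceComplex`),
and `exists_jacobian_isLimit_fan_baseChange` below packages fact + theorem in the shape consumed downstream
(`Summits/HodgeConjecture/CorCM/B01/Transposition/Item6PinReach*.lean`, binder `hAlb`: `Alb_{X_K} ⊗_{E,σ} ℂ` versus
the components of `X_K ⊗_{E,σ} ℂ`).  Nothing else is asserted; no instance, no `variable`.

## References

* [Liu2021] Y. Liu, arXiv:2102.11518 = Camb. J. Math. 9 (2021): §2.1 Def. 2.1 (l. 1171–1184), Proposition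
  (l. 1190–1192) with proof (l. 1194–1200), Def. 2.3 (l. 1202–1208), Lemma 2.2 (1) (l. 1211–1213) with proof
  (l. 1220–1228).
* [AchterCasalainaMartinVial2026] J. D. Achter, S. Casalaina-Martin, Ch. Vial, *A complete answer to Albanese base
  change for incomplete varieties*, Ann. Inst. Fourier 76 (2026) no. 2, 789–828 (= arXiv:2210.05017): Thm. 3.2
  (Grothendieck–Conrad), Rem. 3.3, Thm. 6.1 (text read, pp. 807–808, 825).
* [Grothendieck1962FGA6] A. Grothendieck, *Technique de descente et théorèmes d'existence en géométrie algébrique VI: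
  les schémas de Picard, propriétés générales* (Sém. Bourbaki 236, 1962; FGA), Thm. 3.3 (iii) (locator through
  [AchterCasalainaMartinVial2026, Rem. 3.3]; text not held).
* [Serre1958MorphismesUniversels] J.-P. Serre, *Morphismes universels et variété d'Albanese*, Sém. Chevalley 4
  (1958/59), exp. 10 (Liu's [Ser59]); [Wittenberg2008AlbaneseTorsors] O. Wittenberg, *On Albanese torsors and the
  elementary obstruction*, Math. Ann. 340 (2008), Appendix A (Liu's [Wit08]) — the references OF the printed proof.
* [GortzWedhorn2023] U. Görtz, T. Wedhorn, *Algebraic Geometry II* (2023), Remark 27.221, Remark 27.225 and pp. 908–909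
  (Albanese `= (Pic⁰)^∨` in characteristic `0`; held, text read).
* [Milne1986JacobianVarieties] J. S. Milne, *Jacobian Varieties* (1986), §6 Prop. 6.1, Prop. 6.4, Remark 6.5.
-/

noncomputable section

open CategoryTheory CategoryTheory.Limits AlgebraicGeometry
open Literature.AlgebraicGeometry.Motives

namespace Literature.NumberTheory.Automorphic.Liu2021

/-- **[Liu2021, §2.1, Proposition (unnumbered, l. 1190–1192)] AS PRINTED — the Albanese variety exists.**  «Let `X` be
a proper smooth scheme in `Sch_{/k}`. Consider the functor `\underline{Alb}_X` on the category of abelian varieties `A`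
over `k` such that `\underline{Alb}_X(A)` is the set of morphisms `f : ∇X → A` over `k` such that `ΔX` is contained in
`f^{-1} 0_A`. Then `\underline{Alb}_X` is corepresentable.» (`k` an arbitrary field: «Let `k` be a field. We work in the
category `Sch_{/k}`», l. 1165.)  TYPED: «corepresentable» = there is a corepresenting datum, i.e. an inhabitant of
`AppendixC.Albanese X` (Def. 2.3 as typed in `AppendixC/Glue.lean`: a `∇X`, a REAL abelian variety `Alb_X` over `k`, the
Albanese morphism `α_X : ∇X → Alb_X` with `ΔX ≫ α_X = 0`, and `desc`/`fac`/`uniq`); «proper smooth» = Mathlib `IsProper`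
and `Smooth` of the structure morphism `X → Spec k`.  PRINTED PROOF (l. 1194–1200): over a separable closure `k'`
(which splits `X`) Serre's construction of the Albanese variety ([Ser59]; [Wit08, Appendix A] over a separably closed
field) pointed at one point per connected component, independence of the chosen points, «as `(∇X)_{k'} ≃ ∇_{k'}X'`, the
statement for `X` then follows by Galois descent».  Not consumed by the COR-CM closed term (its Appendix-C carrier
`C : AppendixC.Sec42Data …` stays a posited datum); it is the cited non-vacuity exit for the field `Sec42Data.alb`
(TEAM hComp referee ruling R-2).  Nothing is asserted; a consumer takes `(h : exists_albanese)`.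
[cite: Liu2021, §2.1 Proposition, FJcycle.tex l. 1190–1192, proof l. 1194–1200; Def. 2.3 l. 1202–1208]
[cite: Wittenberg2008AlbaneseTorsors, Appendix A] [cite: Serre1958MorphismesUniversels, exp. 10] -/
def exists_albanese : Prop :=
  ∀ (k : Type) [Field k] (X : SchemeOver k),
    AlgebraicGeometry.IsProper X.hom → AlgebraicGeometry.Smooth X.hom → Nonempty (AppendixC.Albanese X)

/-- **[Liu2021, §2.1] The Albanese variety under extension of the base field, on the components.**  For a field
`k` of characteristic zero, a ring homomorphism `σ : k →+* L` into an algebraically closed field `L`, a proper smooth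
`k`-scheme `X` with an Albanese datum `a` in the sense of Def. 2.3 (`α_X : ∇X → Alb_X` corepresenting
`A ↦ {f : ∇X → A | ΔX ⊆ f⁻¹0_A}`, the Proposition l. 1190–1192), and every finite coproduct decomposition
`inj : Y_c ⟶ X ⊗_{k,σ} L` (a colimit cofan) of the base change into smooth projective (geometrically) irreducible
`L`-schemes `Y_c` carrying Albanese data `𝒥 c : Jacobian (Y c)` (difference map `Y_c × Y_c → J_c` universal among
morphisms trivial on the diagonal — Liu's functor for the connected `Y_c`, `∇Y_c = Y_c × Y_c`), the base change
`Alb_X ⊗_{k,σ} L` is the product `∏_c J_c` in the category of abelian varieties over `L`: there are homomorphisms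
`π_c : Alb_X ⊗_{k,σ} L → J_c` forming a limit fan.  SOURCE MAP (ref R-3 of TEAM hComp: clauses separated):
(a) PRINTED, [Liu2021] proof of the Proposition, l. 1194–1200: for a separable closure `k'` of `k` (which splits `X`),
`Alb_{X'}`, `X' = X_{k'} = ⊔ᵢ Xᵢ`, is corepresented through the difference map by Serre's Albanese of `X'` pointed at
one point per connected component — i.e. by `∏ᵢ Alb_{Xᵢ}` —, «as `(∇X)_{k'} ≃ ∇_{k'}X'`, the statement for `X`
then follows by Galois descent»; (i) NOT PRINTED, immediate: the descended `Alb_X` base-changes back to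
`Alb_{X'} = ∏ᵢ Alb_{Xᵢ}`, and ANY datum `a : Albanese X` is isomorphic to it (corepresenting objects are unique up to
a unique isomorphism, cf. `AppendixC.Albanese.hom_ext`), so the conclusion holds for every `a`; (ii) NOT PRINTED in
[Liu2021] (used silently in the proof of Lemma 2.2 (1), l. 1220–1228: «`(α_X)_x : X ⊗_{k,τ} ℂ → Alb_X ⊗_{k,τ} ℂ`
[…] by the property of complex Albanese varieties […] is an isomorphism»): for each geometrically connected proper
smooth `Xᵢ / k'` and the extension `k' → L` over `σ`, `Alb_{Xᵢ} ⊗_{k'} L` is the Albanese variety of `Xᵢ ⊗_{k'} L`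
— the base-change theorem for Albanese varieties of proper geometrically connected geometrically reduced schemes,
Grothendieck FGA VI Thm. 3.3 (iii) (via `Alb = (Pic⁰_red)^∨` and base change of the Picard scheme), in the form
[AchterCasalainaMartinVial2026, Thm. 3.2 (Grothendieck–Conrad) with Rem. 3.3]: «Let `V` be a proper geometrically
connected and geometrically reduced scheme over a field `K`. Then Albanese data for `V` is stable under base change
of field» (in characteristic `0`, the case at hand, also [GortzWedhorn2023, Remark 27.225 and the discussion after
Prop. 27.226, pp. 908–909]: for a geometrically connected smooth proper pointed `X/k`, `Pic⁰_{X/k}` is an abelian variety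
and its dual `(Pic⁰_{X/k})^∨` is an Albanese variety for `X` — and the Picard scheme and duality commute with base change,
Remark 27.221); the `Xᵢ ⊗_{k'} L` are the connected components of `X ⊗_{k,σ} L`, i.e. the `Y_c` up to reindexing;
(iii) for a geometrically connected `Y` over the algebraically closed `L` (so `Y(L) ≠ ∅`), Serre's pointed Albanese
and the point-free difference-map datum `Jacobian Y` determine each other: Milne, *Jacobian Varieties*, Prop. 6.1 ⇔
Prop. 6.4 and Remark 6.5 (in the tree: `Jacobian.ofPointed`, `Jacobian.descPointed`, `Jacobian.uniqueUpToIso`,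
proved); a finite product of abelian varieties with its projections is the categorical product in `AbelianVariety L`.
STATUS: a cited theorem assembled from (a)+(i)+(ii)+(iii) — DERIVED, not one printed sentence; the existence of the
`𝒥 c` is NOT asserted (over `ℂ` it is the tree's theorem `nonempty_jacobian_of_isSmoothProjective_complex_of_dim`);
`X` itself is NOT assumed geometrically irreducible (Liu's `X_K` is not: `|π₀(X_K ⊗ ℂ)| ≥ 2` in general).
[cite: Liu2021, §2.1 Proposition (FJcycle.tex l. 1190–1192) with proof (l. 1194–1200), Def. 2.3 (l. 1202–1208), Lemma 2.2 (1) (l. 1211–1213, proof l. 1220–1228)]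
[cite: AchterCasalainaMartinVial2026, Thm. 3.2 and Rem. 3.3 (pp. 807–808)]
[cite: Grothendieck1962FGA6, Thm. 3.3 (iii)] [cite: GortzWedhorn2023, Remark 27.225 and pp. 908–909]
[cite: Milne1986JacobianVarieties, §6 Prop. 6.1, Prop. 6.4, Remark 6.5] -/
def albanese_baseChange_isLimit_fan_jacobian : Prop :=
  ∀ (k L : Type) [Field k] [CharZero k] [Field L] [IsAlgClosed L] (σ : k →+* L) (X : SchemeOver k),
    AlgebraicGeometry.IsProper X.hom → AlgebraicGeometry.Smooth X.hom →
    ∀ (a : AppendixC.Albanese X) (n : ℕ) (ι : Type) [Fintype ι] (Y : ι → SchemeOver L)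
      (inj : ∀ c, Y c ⟶ (baseChangeHom σ).obj X) (𝒥 : ∀ c, Jacobian (Y c)),
      (∀ c, IsSmoothProjective n (Y c)) → Nonempty (IsColimit (Cofan.mk ((baseChangeHom σ).obj X) inj)) →
        ∃ π : ∀ c, (letI := σ.toAlgebra; a.Alb.baseChange L) ⟶ (𝒥 c).J,
          Nonempty (IsLimit (Fan.mk (letI := σ.toAlgebra; a.Alb.baseChange L) π))

/-- **The complex case, with the Albanese data of the components supplied by the tree.**  Given the named fact
`albanese_baseChange_isLimit_fan_jacobian`: for `σ : k →+* ℂ`, a proper smooth `X/k` with a Liu Albanese datum `a`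
(Def. 2.3) and a finite coproduct decomposition of `X ⊗_{k,σ} ℂ` into smooth projective geometrically irreducible
complex varieties `Y_c` (of any dimension `n`), there EXIST Albanese data `𝒥 c : Jacobian (Y c)` — by the tree's proved
`Motives.nonempty_jacobian_of_isSmoothProjective_complex_of_dim` (Serre's universal-morphism criterion with the
bound `dim A ≤ b₁`, sorry-free) — and projections exhibiting `Alb_X ⊗_{k,σ} ℂ` as `∏_c (𝒥 c).J`.  This is the shape
in which Lemma 2.2 (1) uses the Albanese over `ℂ` («by the property of complex Albanese varieties», l. 1224).  Ours
(packaging); conditional on the named fact only.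
[cite: Liu2021, §2.1 Proposition (FJcycle.tex l. 1190–1200), Lemma 2.2 (1) (l. 1211–1228)] -/
theorem exists_jacobian_isLimit_fan_baseChange (h : albanese_baseChange_isLimit_fan_jacobian)
    {k : Type} [Field k] [CharZero k] (σ : k →+* ℂ) (X : SchemeOver k)
    (hXp : AlgebraicGeometry.IsProper X.hom) (hXs : AlgebraicGeometry.Smooth X.hom)
    (a : AppendixC.Albanese X) (n : ℕ) {ι : Type} [Fintype ι] (Y : ι → SchemeOver ℂ)
    (inj : ∀ c, Y c ⟶ (baseChangeHom σ).obj X) (hY : ∀ c, IsSmoothProjective n (Y c))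
    (hcol : Nonempty (IsColimit (Cofan.mk ((baseChangeHom σ).obj X) inj))) :
    ∃ (𝒥 : ∀ c, Jacobian (Y c)) (π : ∀ c, (letI := σ.toAlgebra; a.Alb.baseChange ℂ) ⟶ (𝒥 c).J),
      Nonempty (IsLimit (Fan.mk (letI := σ.toAlgebra; a.Alb.baseChange ℂ) π)) := by
  have 𝒥 : ∀ c, Jacobian (Y c) := fun c =>
    (nonempty_jacobian_of_isSmoothProjective_complex_of_dim (Y c) (hY c)).some
  obtain ⟨π, hπ⟩ := h k ℂ σ X hXp hXs a n ι Y inj 𝒥 hY hcol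
  exact ⟨𝒥, π, hπ⟩

/-- The same over `ℂ` for a PROJECTIVE smooth `X/k` of some relative dimension `m` — the attributes printed for Liu's
`X_K = S̃h(𝕍)_K` in §4.2 l. 2064 («smooth projective schemes in `Sch_{/E}` of dimension `n − 1`», the fields
`CompactifiedSystem.smooth_X` / `projective_X` of `AppendixC/Glue.lean`): properness from projectivity
(`IsProjectiveOver.isProper`) and smoothness from smoothness of a relative dimension.  Ours (packaging).
[cite: Liu2021, §4.2 l. 2060–2066 and §2.1 Lemma 2.2 (1)] -/
theorem exists_jacobian_isLimit_fan_baseChange_of_isProjectiveOver (h : albanese_baseChange_isLimit_fan_jacobian)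
    {k : Type} [Field k] [CharZero k] (σ : k →+* ℂ) (X : SchemeOver k) {m : ℕ}
    (hXp : IsProjectiveOver X) (hXs : SmoothOfRelativeDimension m X.hom)
    (a : AppendixC.Albanese X) (n : ℕ) {ι : Type} [Fintype ι] (Y : ι → SchemeOver ℂ)
    (inj : ∀ c, Y c ⟶ (baseChangeHom σ).obj X) (hY : ∀ c, IsSmoothProjective n (Y c))
    (hcol : Nonempty (IsColimit (Cofan.mk ((baseChangeHom σ).obj X) inj))) :
    ∃ (𝒥 : ∀ c, Jacobian (Y c)) (π : ∀ c, (letI := σ.toAlgebra; a.Alb.baseChange ℂ) ⟶ (𝒥 c).J),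
      Nonempty (IsLimit (Fan.mk (letI := σ.toAlgebra; a.Alb.baseChange ℂ) π)) :=
  haveI := hXs
  exists_jacobian_isLimit_fan_baseChange h σ X hXp.isProper (SmoothOfRelativeDimension.smooth m X.hom) a n Y inj
    hY hcol

end Literature.NumberTheory.Automorphic.Liu2021

end
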